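import Mathlib
import Literature.Dynamics.FixedPoints.UnstableSetNull
import HarnessLib

/-!
# Dominated splittings: the trapped set and the backward basin of a point with ONE strictly contracting,
# dominated direction are Lebesgue-null (cone estimate; Katok–Hasselblatt §6.2, Robinson Ch. V §5.10.1)

Topic `Literature/Dynamics/FixedPoints`.  Sequel to `UnstableSetNull` (the hyperbolic case: `‖DF|Es‖ ≤ ½`,
`‖DF x‖ ≥ 2‖x‖` on `Eu`).  The cone argument there never uses EXPANSION of the complement: it only needs the
stable rate `a` to be `< 1` and to be DOMINATED by the lower rate `b` of the complementary invariant subspace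
(`a < b`; `b < 1` is allowed).  This is the «pseudo-hyperbolic» / dominated-splitting form of the Hadamard–Perron
cone estimate, and it covers NON-HYPERBOLIC points — e.g. an equilibrium of a flow whose linearisation has the
eigenvalues `{0, λ₊, λ₋}` with `λ₋ < 0` (a point on a curve of equilibria with one transversally contracting
direction): the set of points with a past history trapped near such a point, and hence the set of points converging
backward to it, is Lebesgue-null as soon as the contracting subspace is nontrivial.

* `norm_projection_le_of_pastHistories_of_dominated` — cone lemma with rates `‖DF(p)|Es‖ ≤ a`,
  `‖DF(p)x‖ ≥ b‖x‖` on `Ec`, `a < 1`, `a < b`: two `F`-past histories inside a small ball `B(p, r)` have initial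
  difference in the `Ec`-cone;
* `hausdorffMeasure_localTrappedSet_eq_zero_of_dominated` — the local trapped set is a `2`-Lipschitz graph over
  `Ec`, `μH[finrank]`-null when `Ec ≠ ⊤`;
* `addHaar_pastHistorySet_eq_zero_of_dominated` — global form for a `C¹` map `F` (histories converging to `p`);
* `addHaar_setOf_tendsto_atBot_eq_zero_of_dominated` — flow form with an arbitrary sampling time `T > 0` (rates
  for `D(Φ_T)(p)`), so that consumers can take `T` large.

Consumer: the Navier–Stokes §B crux `PowerGaugeEulerLiouville` (item stmt-NavierStokesRegularity-19832), rung C1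
residue «uncountable stagnation sets»: degenerate stagnation points of an in-window self-similar profile on a
stagnation curve have linearisation spectrum `{s+γ, 0, 2γ−s}`, `s ≥ 1`, i.e. one dominated contracting direction.

## References

* C. Robinson, *Dynamical Systems*, 2nd ed. (1999), Ch. V §5.10.1 (cone estimate in the proof of Thm 10.1).
  [Robinson1999]
* J. K. Hale, L. T. Magalhães, W. M. Oliva, *Dynamics in Infinite Dimensions* (2002), Def. 7.2.1.
  [HaleMagalhaesOliva2002]
-/

noncomputable section

open Filter Set Function Topology MeasureTheory Metric

namespace Literature.Dynamics.FixedPoints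

universe u

variable {E : Type u} [NormedAddCommGroup E] [NormedSpace ℝ E] [FiniteDimensional ℝ E]

omit [FiniteDimensional ℝ E] in
/-- The projections commute with a map preserving both summands: `π_s(Lw) = L(π_s w)`. [folklore] -/
private theorem projection_map_of_invariant' {Es Ec : Submodule ℝ E} (hcompl : IsCompl Es Ec) (L : E →L[ℝ] E)
    (hs : ∀ x ∈ Es, L x ∈ Es) (hu : ∀ x ∈ Ec, L x ∈ Ec) (w : E) :
    Es.projection Ec hcompl (L w) = L (Es.projection Ec hcompl w) := by
  conv_lhs => rw [← Submodule.projection_add_projection_eq_self hcompl w]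
  rw [map_add, map_add, Submodule.projection_apply_of_mem_left hcompl (hs _ (Submodule.projection_apply_mem hcompl w)),
    Submodule.projection_apply_of_mem_right hcompl (hu _ (Submodule.projection_apply_mem hcompl.symm w)), add_zero]

/-- A past history of `F` recovers its initial point: `F^[i] (q_{j+i}) = q_j`. [folklore] -/
private theorem iterate_apply_pastHistory' {X : Type*} {F : X → X} {qs : ℕ → X}
    (hqs : ∀ j, F (qs (j + 1)) = qs j) (i j : ℕ) : F^[i] (qs (j + i)) = qs j := by
  induction i generalizing j with
  | zero => rfl
  | succ i ih =>
      rw [Function.iterate_succ_apply, show j + (i + 1) = (j + i) + 1 by ring, hqs (j + i)]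
      exact ih j

section Dominated

variable {F : E → E} {p : E} {Es Ec : Submodule ℝ E}

/-- **THE CONE LEMMA FOR A DOMINATED SPLITTING** (Katok–Hasselblatt §6.2; Hirsch–Pugh–Shub): let `F` be `C¹` and let
`DF(p)` preserve the complementary subspaces `Es`, `Ec` with `‖DF(p) x‖ ≤ a‖x‖` on `Es`, `b‖x‖ ≤ ‖DF(p) x‖` on `Ec`,
where `a < 1` and `a < b`.  Then there is `r > 0` such that any two `F`-past histories contained in `B(p, r)` have
initial difference in the `Ec`-cone: `‖π_s(q₀ − q₀')‖ ≤ ‖π_c(q₀ − q₀')‖`. [cite: Robinson1999, Ch. V §5.10.1 (proof of Thm 10.1, cone estimate; dominated form)] -/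
theorem norm_projection_le_of_pastHistories_of_dominated (hF : ContDiff ℝ 1 F)
    (hcompl : IsCompl Es Ec) (hs : ∀ x ∈ Es, fderiv ℝ F p x ∈ Es) (hc : ∀ x ∈ Ec, fderiv ℝ F p x ∈ Ec)
    {a b : ℝ} (ha1 : a < 1) (hab : a < b)
    (hcon : ∀ x ∈ Es, ‖fderiv ℝ F p x‖ ≤ a * ‖x‖) (hdom : ∀ x ∈ Ec, b * ‖x‖ ≤ ‖fderiv ℝ F p x‖) :
    ∃ r : ℝ, 0 < r ∧ ∀ qs qs' : ℕ → E, (∀ k, F (qs (k + 1)) = qs k) → (∀ k, F (qs' (k + 1)) = qs' k) →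
      (∀ k, qs k ∈ ball p r) → (∀ k, qs' k ∈ ball p r) →
        ‖Es.projection Ec hcompl (qs 0 - qs' 0)‖ ≤ ‖Ec.projection Es hcompl.symm (qs 0 - qs' 0)‖ := by
  set L : E →L[ℝ] E := fderiv ℝ F p with hLdef
  set Ps : E →L[ℝ] E := LinearMap.toContinuousLinearMap (Es.projection Ec hcompl) with hPs
  set Pu : E →L[ℝ] E := LinearMap.toContinuousLinearMap (Ec.projection Es hcompl.symm) with hPu
  have hPs_apply : ∀ w, Ps w = Es.projection Ec hcompl w := fun w => rfl
  have hPu_apply : ∀ w, Pu w = Ec.projection Es hcompl.symm w := fun w => rfl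
  set P : ℝ := max ‖Ps‖ ‖Pu‖ + 1 with hPdef
  have hP0 : 0 < P := by rw [hPdef]; positivity
  have hPs_le : ∀ w, ‖Ps w‖ ≤ P * ‖w‖ := fun w =>
    (Ps.le_opNorm w).trans (mul_le_mul_of_nonneg_right (by rw [hPdef]; linarith [le_max_left ‖Ps‖ ‖Pu‖])
      (norm_nonneg _))
  have hPu_le : ∀ w, ‖Pu w‖ ≤ P * ‖w‖ := fun w =>
    (Pu.le_opNorm w).trans (mul_le_mul_of_nonneg_right (by rw [hPdef]; linarith [le_max_right ‖Ps‖ ‖Pu‖])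
      (norm_nonneg _))
  -- `a ≥ 0` unless `Es = ⊥`; in any case we may work with `a⁺ = max a 0`
  set a' : ℝ := max a 0 with ha'def
  have ha'0 : 0 ≤ a' := le_max_right _ _
  have ha'1 : a' < 1 := max_lt ha1 one_pos
  have ha'b : a' < b ∨ Es = ⊥ := by
    by_cases hEs : Es = ⊥
    · exact Or.inr hEs
    · left
      -- some `x ∈ Es`, `x ≠ 0`, gives `0 ≤ a`
      obtain ⟨x, hx, hx0⟩ := (Submodule.ne_bot_iff Es).1 hEs
      have h1 := hcon x hx
      have hxpos : 0 < ‖x‖ := norm_pos_iff.2 hx0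
      have ha0 : 0 ≤ a := by nlinarith [norm_nonneg (L x)]
      rw [ha'def, max_eq_left ha0]; exact hab
  have hcon' : ∀ x ∈ Es, ‖L x‖ ≤ a' * ‖x‖ := fun x hx =>
    (hcon x hx).trans (mul_le_mul_of_nonneg_right (le_max_left _ _) (norm_nonneg _))
  -- `δ`: a quarter of the two gaps `1 − a'`, `b − a'` (the latter only when `Es ≠ ⊥`)
  set δ : ℝ := if Es = ⊥ then (1 - a') / 4 else min ((1 - a') / 4) ((b - a') / 4) with hδdef
  have hδ : 0 < δ := by
    rw [hδdef]; split_ifs with h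
    · linarith
    · rcases ha'b with hlt | hbot
      · exact lt_min (by linarith) (by linarith)
      · exact absurd hbot h
  have hδ1 : a' + 2 * δ < 1 := by
    have : δ ≤ (1 - a') / 4 := by rw [hδdef]; split_ifs <;> [exact le_rfl; exact min_le_left _ _]
    linarith
  have hδb : Es ≠ ⊥ → a' + 2 * δ ≤ b - 2 * δ := by
    intro h
    have : δ ≤ (b - a') / 4 := by rw [hδdef, if_neg h]; exact min_le_right _ _
    linarith
  set ε : ℝ := δ / P with hεdef
  have hε : 0 < ε := by rw [hεdef]; positivity
  have hPε : P * ε = δ := by rw [hεdef]; field_simp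
  -- radius: `‖DF(q) − L‖ ≤ ε` on `B(p, r)`
  have hDFc : Continuous (fderiv ℝ F) := hF.continuous_fderiv one_ne_zero
  obtain ⟨r, hr, hrε⟩ : ∃ r > 0, ∀ q, dist q p < r → dist (fderiv ℝ F q) (fderiv ℝ F p) < ε :=
    Metric.continuousAt_iff.1 hDFc.continuousAt ε hε
  refine ⟨r, hr, fun qs qs' hqs hqs' hB hB' => ?_⟩
  have hFd : Differentiable ℝ F := hF.differentiable one_ne_zero
  have hg : ∀ x ∈ ball p r, ∀ y ∈ ball p r, ‖(F y - L y) - (F x - L x)‖ ≤ ε * ‖y - x‖ := by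
    intro x hx y hy
    have h := (convex_ball p r).norm_image_sub_le_of_norm_fderiv_le (f := fun z => F z - L z) (C := ε)
      (fun z _ => (hFd z).sub (L.differentiableAt)) (fun z hz => ?_) hx hy
    · exact h
    · rw [fderiv_fun_sub (hFd z) L.differentiableAt, ContinuousLinearMap.fderiv]
      rw [← dist_eq_norm]
      exact (hrε z (mem_ball.1 hz)).le
  set w : ℕ → E := fun k => qs k - qs' k with hw
  set s : ℕ → ℝ := fun k => ‖Ps (w k)‖ with hsdef
  set u : ℕ → ℝ := fun k => ‖Pu (w k)‖ with hudef
  have hwsum : ∀ k, ‖w k‖ ≤ s k + u k := by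
    intro k
    have e : w k = Ps (w k) + Pu (w k) := by
      rw [hPs_apply, hPu_apply, Submodule.projection_add_projection_eq_self]
    calc ‖w k‖ = ‖Ps (w k) + Pu (w k)‖ := by rw [← e]
      _ ≤ s k + u k := norm_add_le _ _
  have hstep : ∀ k, ‖w k - L (w (k + 1))‖ ≤ ε * ‖w (k + 1)‖ := by
    intro k
    have h := hg (qs' (k + 1)) (hB' (k + 1)) (qs (k + 1)) (hB (k + 1))
    have e : w k - L (w (k + 1)) = (F (qs (k + 1)) - L (qs (k + 1))) - (F (qs' (k + 1)) - L (qs' (k + 1))) := by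
      simp only [hw, map_sub, hqs k, hqs' k]; abel
    rw [e]
    exact h
  have hcomm_s : ∀ v, Ps (L v) = L (Ps v) := fun v => by
    rw [hPs_apply, hPs_apply]; exact projection_map_of_invariant' hcompl L hs hc v
  have hcomm_u : ∀ v, Pu (L v) = L (Pu v) := fun v => by
    rw [hPu_apply, hPu_apply]; exact projection_map_of_invariant' hcompl.symm L hc hs v
  -- (E1) `s k ≤ a' s (k+1) + δ ‖w (k+1)‖`
  have hE1 : ∀ k, s k ≤ a' * s (k + 1) + δ * ‖w (k + 1)‖ := by
    intro k
    have e : Ps (w k) = L (Ps (w (k + 1))) + Ps (w k - L (w (k + 1))) := by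
      rw [map_sub Ps (w k) (L (w (k + 1))), hcomm_s]; abel
    have h1 : ‖L (Ps (w (k + 1)))‖ ≤ a' * ‖Ps (w (k + 1))‖ :=
      hcon' _ (by rw [hPs_apply]; exact Submodule.projection_apply_mem hcompl _)
    have h2 : ‖Ps (w k - L (w (k + 1)))‖ ≤ δ * ‖w (k + 1)‖ := by
      calc ‖Ps (w k - L (w (k + 1)))‖ ≤ P * ‖w k - L (w (k + 1))‖ := hPs_le _
        _ ≤ P * (ε * ‖w (k + 1)‖) := mul_le_mul_of_nonneg_left (hstep k) hP0.le
        _ = δ * ‖w (k + 1)‖ := by rw [← hPε]; ring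
    calc s k = ‖Ps (w k)‖ := rfl
      _ = ‖L (Ps (w (k + 1))) + Ps (w k - L (w (k + 1)))‖ := by rw [← e]
      _ ≤ ‖L (Ps (w (k + 1)))‖ + ‖Ps (w k - L (w (k + 1)))‖ := norm_add_le _ _
      _ ≤ a' * s (k + 1) + δ * ‖w (k + 1)‖ := add_le_add h1 h2
  -- (E2) `b u (k+1) − δ ‖w (k+1)‖ ≤ u k`
  have hE2 : ∀ k, b * u (k + 1) - δ * ‖w (k + 1)‖ ≤ u k := by
    intro k
    have e : L (Pu (w (k + 1))) = Pu (w k) - Pu (w k - L (w (k + 1))) := by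
      rw [map_sub Pu (w k) (L (w (k + 1))), hcomm_u]; abel
    have h1 : b * ‖Pu (w (k + 1))‖ ≤ ‖L (Pu (w (k + 1)))‖ :=
      hdom _ (by rw [hPu_apply]; exact Submodule.projection_apply_mem hcompl.symm _)
    have h2 : ‖Pu (w k - L (w (k + 1)))‖ ≤ δ * ‖w (k + 1)‖ := by
      calc ‖Pu (w k - L (w (k + 1)))‖ ≤ P * ‖w k - L (w (k + 1))‖ := hPu_le _
        _ ≤ P * (ε * ‖w (k + 1)‖) := mul_le_mul_of_nonneg_left (hstep k) hP0.le
        _ = δ * ‖w (k + 1)‖ := by rw [← hPε]; ring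
    have h3 : ‖L (Pu (w (k + 1)))‖ ≤ ‖Pu (w k)‖ + ‖Pu (w k - L (w (k + 1)))‖ := by
      rw [e]; exact norm_sub_le _ _
    calc b * u (k + 1) - δ * ‖w (k + 1)‖ ≤ ‖L (Pu (w (k + 1)))‖ - ‖Pu (w k - L (w (k + 1)))‖ := by
          have := h1; have := h2; simp only [hudef]; linarith
      _ ≤ u k := by simp only [hudef]; linarith
  -- if `Es = ⊥` the claim is trivial (`s ≡ 0`)
  by_cases hEs : Es = ⊥
  · have h0 : Ps (w 0) = 0 := by
      have hmem : Ps (w 0) ∈ Es := by rw [hPs_apply]; exact Submodule.projection_apply_mem hcompl _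
      rw [hEs, Submodule.mem_bot] at hmem
      exact hmem
    show ‖Ps (w 0)‖ ≤ ‖Pu (w 0)‖
    rw [h0, norm_zero]; exact norm_nonneg _
  have hgap : a' + 2 * δ ≤ b - 2 * δ := hδb hEs
  by_contra hcone
  push Not at hcone
  have hcone0 : u 0 < s 0 := hcone
  -- growth factor `ρ = 1/(a' + 2δ) > 1`
  have hρpos : 0 < a' + 2 * δ := by linarith
  have hind : ∀ k, u k < s k ∧ s 0 ≤ (a' + 2 * δ) ^ k * s k := by
    intro k
    induction k with
    | zero => exact ⟨hcone0, by simp⟩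
    | succ k ih =>
        obtain ⟨ihk, ihg⟩ := ih
        have hu0 : 0 ≤ u k := norm_nonneg _
        have hs1 : 0 ≤ s (k + 1) := norm_nonneg _
        have hu1 : 0 ≤ u (k + 1) := norm_nonneg _
        have e1 := hE1 k
        have e2 := hE2 k
        have ws := hwsum (k + 1)
        have hlt : u (k + 1) < s (k + 1) := by
          by_contra hge
          push Not at hge
          have hw2 : ‖w (k + 1)‖ ≤ 2 * u (k + 1) := by linarith
          have h1 : s k ≤ (a' + 2 * δ) * u (k + 1) := by
            calc s k ≤ a' * s (k + 1) + δ * ‖w (k + 1)‖ := e1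
              _ ≤ a' * u (k + 1) + δ * (2 * u (k + 1)) := by nlinarith
              _ = (a' + 2 * δ) * u (k + 1) := by ring
          have h2 : (b - 2 * δ) * u (k + 1) ≤ u k := by
            calc (b - 2 * δ) * u (k + 1) = b * u (k + 1) - δ * (2 * u (k + 1)) := by ring
              _ ≤ b * u (k + 1) - δ * ‖w (k + 1)‖ := by nlinarith
              _ ≤ u k := e2
          -- `s k ≤ (a'+2δ) u' ≤ (b−2δ) u' ≤ u k`
          have h3 : (a' + 2 * δ) * u (k + 1) ≤ (b - 2 * δ) * u (k + 1) :=
            mul_le_mul_of_nonneg_right hgap hu1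
          linarith
        refine ⟨hlt, ?_⟩
        have hw2 : ‖w (k + 1)‖ ≤ 2 * s (k + 1) := by linarith
        have h1 : s k ≤ (a' + 2 * δ) * s (k + 1) := by
          calc s k ≤ a' * s (k + 1) + δ * ‖w (k + 1)‖ := e1
            _ ≤ a' * s (k + 1) + δ * (2 * s (k + 1)) := by nlinarith
            _ = (a' + 2 * δ) * s (k + 1) := by ring
        calc s 0 ≤ (a' + 2 * δ) ^ k * s k := ihg
          _ ≤ (a' + 2 * δ) ^ k * ((a' + 2 * δ) * s (k + 1)) :=
              mul_le_mul_of_nonneg_left h1 (pow_nonneg hρpos.le k)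
          _ = (a' + 2 * δ) ^ (k + 1) * s (k + 1) := by ring
  -- `s k ≤ 2 P r` is bounded while `(a'+2δ)^k → 0` and `s 0 > 0`
  have hbdd : ∀ k, s k ≤ P * (2 * r) := by
    intro k
    have h1 : ‖w k‖ ≤ 2 * r := by
      have hq := mem_ball.1 (hB k)
      have hq' := mem_ball.1 (hB' k)
      rw [dist_eq_norm] at hq hq'
      calc ‖w k‖ = ‖(qs k - p) - (qs' k - p)‖ := by simp [hw]
        _ ≤ ‖qs k - p‖ + ‖qs' k - p‖ := norm_sub_le _ _
        _ ≤ 2 * r := by linarith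
    exact (hPs_le _).trans (mul_le_mul_of_nonneg_left h1 hP0.le)
  have hs0 : 0 < s 0 := lt_of_le_of_lt (norm_nonneg _) hcone0
  have htend : Tendsto (fun k : ℕ => (a' + 2 * δ) ^ k * (P * (2 * r))) atTop (𝓝 (0 * (P * (2 * r)))) :=
    (tendsto_pow_atTop_nhds_zero_of_lt_one hρpos.le hδ1).mul_const _
  rw [zero_mul] at htend
  obtain ⟨k, hk⟩ := (htend.eventually (gt_mem_nhds hs0)).exists
  have h1 := (hind k).2
  have h2 : (a' + 2 * δ) ^ k * s k ≤ (a' + 2 * δ) ^ k * (P * (2 * r)) :=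
    mul_le_mul_of_nonneg_left (hbdd k) (pow_nonneg hρpos.le k)
  linarith

variable [MeasurableSpace E] [BorelSpace E]

/-- **The local trapped set of a dominated splitting with a nontrivial contracting subspace is null**: under the
hypotheses of `norm_projection_le_of_pastHistories_of_dominated` with `Ec ≠ ⊤`, the set of points admitting an
`F`-past history inside `B(p, r)` is `μH[finrank]`-null (a `2`-Lipschitz graph over the proper subspace `Ec`).
[cite: Robinson1999, Ch. V §5.10.1 (W^u_loc is a Lipschitz graph; dominated form)] -/
theorem hausdorffMeasure_localTrappedSet_eq_zero_of_dominated (hF : ContDiff ℝ 1 F)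
    (hcompl : IsCompl Es Ec) (hs : ∀ x ∈ Es, fderiv ℝ F p x ∈ Es) (hc : ∀ x ∈ Ec, fderiv ℝ F p x ∈ Ec)
    {a b : ℝ} (ha1 : a < 1) (hab : a < b)
    (hcon : ∀ x ∈ Es, ‖fderiv ℝ F p x‖ ≤ a * ‖x‖) (hdom : ∀ x ∈ Ec, b * ‖x‖ ≤ ‖fderiv ℝ F p x‖)
    (hEc : Ec ≠ ⊤) :
    ∃ r : ℝ, 0 < r ∧ μH[Module.finrank ℝ E]
      {q : E | ∃ qs : ℕ → E, qs 0 = q ∧ (∀ k, F (qs (k + 1)) = qs k) ∧ ∀ k, qs k ∈ ball p r} = 0 := by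
  obtain ⟨r, hr, hcone⟩ := norm_projection_le_of_pastHistories_of_dominated hF hcompl hs hc ha1 hab hcon hdom
  refine ⟨r, hr, ?_⟩
  set W : Set E := {q : E | ∃ qs : ℕ → E, qs 0 = q ∧ (∀ k, F (qs (k + 1)) = qs k) ∧ ∀ k, qs k ∈ ball p r}
    with hW
  set πu : E → E := fun x => Ec.projection Es hcompl.symm x with hπu
  have hkey : ∀ q ∈ W, ∀ q' ∈ W, ‖q - q'‖ ≤ 2 * ‖πu q - πu q'‖ := by
    rintro q ⟨qs, rfl, hqs, hB⟩ q' ⟨qs', rfl, hqs', hB'⟩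
    have h := hcone qs qs' hqs hqs' hB hB'
    have e : qs 0 - qs' 0 = Es.projection Ec hcompl (qs 0 - qs' 0) + Ec.projection Es hcompl.symm (qs 0 - qs' 0) :=
      (Submodule.projection_add_projection_eq_self hcompl _).symm
    have hπ : πu (qs 0) - πu (qs' 0) = Ec.projection Es hcompl.symm (qs 0 - qs' 0) := by
      simp only [hπu, map_sub]
    rw [hπ]
    calc ‖qs 0 - qs' 0‖ = ‖Es.projection Ec hcompl (qs 0 - qs' 0) + Ec.projection Es hcompl.symm (qs 0 - qs' 0)‖ := by
          rw [← e]
      _ ≤ ‖Es.projection Ec hcompl (qs 0 - qs' 0)‖ + ‖Ec.projection Es hcompl.symm (qs 0 - qs' 0)‖ :=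
          norm_add_le _ _
      _ ≤ 2 * ‖Ec.projection Es hcompl.symm (qs 0 - qs' 0)‖ := by linarith
  set g : E → E := Function.invFunOn πu W with hg
  have hgW : ∀ x ∈ πu '' W, g x ∈ W ∧ πu (g x) = x := fun x hx =>
    Function.invFunOn_pos (by obtain ⟨q, hq, rfl⟩ := hx; exact ⟨q, hq, rfl⟩)
  have hLip : LipschitzOnWith 2 g (πu '' W) := by
    refine LipschitzOnWith.of_dist_le_mul fun x hx y hy => ?_
    obtain ⟨hgx, hx'⟩ := hgW x hx
    obtain ⟨hgy, hy'⟩ := hgW y hy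
    rw [dist_eq_norm, dist_eq_norm]
    have h := hkey _ hgx _ hgy
    rw [hx', hy'] at h
    exact_mod_cast h
  have hWsub : W ⊆ g '' (πu '' W) := by
    intro q hq
    have hx : πu q ∈ πu '' W := mem_image_of_mem _ hq
    obtain ⟨hgx, hx'⟩ := hgW _ hx
    refine ⟨πu q, hx, ?_⟩
    have h := hkey _ hgx _ hq
    rw [hx', sub_self, norm_zero, mul_zero] at h
    have : g (πu q) - q = 0 := norm_le_zero_iff.1 h
    exact sub_eq_zero.1 this
  have hd : (0 : ℝ) ≤ (Module.finrank ℝ E : ℝ) := Nat.cast_nonneg _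
  have hEc0 : μH[Module.finrank ℝ E] (Ec : Set E) = 0 := Measure.addHaar_submodule _ Ec hEc
  have hD0 : μH[Module.finrank ℝ E] (πu '' W) = 0 :=
    measure_mono_null (by rintro _ ⟨q, -, rfl⟩; exact Submodule.projection_apply_mem hcompl.symm q) hEc0
  have himg : μH[Module.finrank ℝ E] (g '' (πu '' W)) = 0 := by
    have h := hLip.hausdorffMeasure_image_le hd
    rw [hD0, mul_zero] at h
    exact le_antisymm h bot_le
  exact measure_mono_null hWsub himg

/-- **Past-history set of a point with a dominated contracting direction is null.**  Let `F : E → E` be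
`C¹` and let `DF(p)` preserve complementary subspaces `Es`, `Ec` (`Ec ≠ ⊤`) with rates
`‖DF(p)x‖ ≤ a‖x‖` on `Es`, `b‖x‖ ≤ ‖DF(p)x‖` on `Ec`, `a < 1`, `a < b` — no expansion required, so `p` may be
NON-HYPERBOLIC (e.g. on a curve of fixed points with a transversally contracting direction).  Then the set of points
admitting an `F`-past history converging to `p` has measure zero for every additive Haar measure.
[cite: Robinson1999, Ch. V Thm 10.1 (proof, cone estimate; dominated form)] -/
theorem addHaar_pastHistorySet_eq_zero_of_dominated (μ : Measure E) [μ.IsAddHaarMeasure]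
    (hF : ContDiff ℝ 1 F)
    (hcompl : IsCompl Es Ec) (hs : ∀ x ∈ Es, fderiv ℝ F p x ∈ Es) (hc : ∀ x ∈ Ec, fderiv ℝ F p x ∈ Ec)
    {a b : ℝ} (ha1 : a < 1) (hab : a < b)
    (hcon : ∀ x ∈ Es, ‖fderiv ℝ F p x‖ ≤ a * ‖x‖) (hdom : ∀ x ∈ Ec, b * ‖x‖ ≤ ‖fderiv ℝ F p x‖)
    (hEc : Ec ≠ ⊤) :
    μ {q | ∃ qs : ℕ → E, qs 0 = q ∧ (∀ j, F (qs (j + 1)) = qs j) ∧ Tendsto qs atTop (𝓝 p)} = 0 := by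
  obtain ⟨r, hr, hW0⟩ :=
    hausdorffMeasure_localTrappedSet_eq_zero_of_dominated (p := p) hF hcompl hs hc ha1 hab hcon hdom hEc
  set W : Set E := {q : E | ∃ qs : ℕ → E, qs 0 = q ∧ (∀ k, F (qs (k + 1)) = qs k) ∧ ∀ k, qs k ∈ ball p r}
    with hW
  have hμW : μ W = 0 :=
    (Measure.absolutelyContinuous_isAddHaarMeasure μ (μH[Module.finrank ℝ E])) hW0
  have hFd : Differentiable ℝ F := hF.differentiable one_ne_zero
  have hNj : ∀ j : ℕ, μ (F^[j] '' W) = 0 := fun j =>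
    addHaar_image_eq_zero_of_differentiableOn_of_addHaar_eq_zero μ (hFd.iterate j).differentiableOn hμW
  refine measure_mono_null (fun q hq => ?_) (measure_iUnion_null hNj)
  obtain ⟨qs, h0, hstep, hlim⟩ := hq
  obtain ⟨K, hK⟩ := eventually_atTop.1 (hlim.eventually (ball_mem_nhds p hr))
  have hmem : qs K ∈ W := by
    refine ⟨fun i => qs (K + i), by simp, fun i => ?_, fun i => hK _ (Nat.le_add_right _ _)⟩
    show F (qs (K + (i + 1))) = qs (K + i)
    rw [show K + (i + 1) = (K + i) + 1 by ring]
    exact hstep (K + i)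
  refine mem_iUnion.2 ⟨K, ?_⟩
  rw [← h0, ← iterate_apply_pastHistory' hstep K 0, zero_add]
  exact mem_image_of_mem _ hmem

omit [NormedSpace ℝ E] [FiniteDimensional ℝ E] [MeasurableSpace E] [BorelSpace E] in
/-- Along a one-parameter group, a point converging to `p` as `s → −∞` has, for every sampling time `T`, the past
history `q_{-j} = Φ(−jT) y` under `Φ T` converging to `p`. [cite: Robinson1999, Ch. V §5.10.3] -/
theorem exists_pastHistory_of_tendsto_atBot_sampling {Φ : ℝ → E → E} (hΦ0 : ∀ y, Φ 0 y = y)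
    (hΦ : ∀ s t y, Φ (s + t) y = Φ s (Φ t y)) {T : ℝ} (hT : 0 < T) {p y : E}
    (hy : Tendsto (fun s => Φ s y) atBot (𝓝 p)) :
    ∃ qs : ℕ → E, qs 0 = y ∧ (∀ j, Φ T (qs (j + 1)) = qs j) ∧ Tendsto qs atTop (𝓝 p) := by
  refine ⟨fun j => Φ (-((j : ℝ) * T)) y, by simpa using hΦ0 y, fun j => ?_, ?_⟩
  · show Φ T (Φ (-(((j + 1 : ℕ) : ℝ) * T)) y) = Φ (-((j : ℝ) * T)) y
    rw [← hΦ]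
    congr 1
    push_cast
    ring
  · refine hy.comp ?_
    have h1 : Tendsto (fun j : ℕ => (j : ℝ) * T) atTop atTop :=
      tendsto_natCast_atTop_atTop.atTop_mul_const hT
    exact tendsto_neg_atTop_atBot.comp h1

/-- **Flows: the backward basin of an equilibrium with a dominated contracting direction is Lebesgue-null.**  `Φ`
is a one-parameter group; for some sampling time `T > 0` the time-`T` map is `C¹` and its derivative
at `p` preserves complementary subspaces `Es`, `Ec` (`Ec ≠ ⊤`) with rates `a < 1`, `a < b` as above.  Then
`{y : Φ_s y → p as s → −∞}` is null — `p` need not be hyperbolic.  [cite: Robinson1999, Ch. V Thm 10.1 and §5.10.3 (dominated form)] -/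
theorem addHaar_setOf_tendsto_atBot_eq_zero_of_dominated (μ : Measure E) [μ.IsAddHaarMeasure]
    {Φ : ℝ → E → E} (hΦ0 : ∀ y, Φ 0 y = y) (hΦ : ∀ s t y, Φ (s + t) y = Φ s (Φ t y))
    {T : ℝ} (hT : 0 < T) (h1 : ContDiff ℝ 1 (Φ T)) {p : E} {Es Ec : Submodule ℝ E}
    (hcompl : IsCompl Es Ec) (hs : ∀ x ∈ Es, fderiv ℝ (Φ T) p x ∈ Es) (hc : ∀ x ∈ Ec, fderiv ℝ (Φ T) p x ∈ Ec)
    {a b : ℝ} (ha1 : a < 1) (hab : a < b)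
    (hcon : ∀ x ∈ Es, ‖fderiv ℝ (Φ T) p x‖ ≤ a * ‖x‖) (hdom : ∀ x ∈ Ec, b * ‖x‖ ≤ ‖fderiv ℝ (Φ T) p x‖)
    (hEc : Ec ≠ ⊤) :
    μ {y | Tendsto (fun s => Φ s y) atBot (𝓝 p)} = 0 :=
  measure_mono_null (fun _ hy => exists_pastHistory_of_tendsto_atBot_sampling hΦ0 hΦ hT hy)
    (addHaar_pastHistorySet_eq_zero_of_dominated μ h1 hcompl hs hc ha1 hab hcon hdom hEc)

end Dominated

end Literature.Dynamics.FixedPoints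

end
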